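/-
Copyright (c) 2026. Released under the Apache 2.0 license.
-/
import Literature.NumberTheory.EllipticCurves.ManinConstantClassCertificate
import Literature.NumberTheory.EllipticCurves.SkinnerUrban2014.PAdicUnitPeriodRatioAnyPrimeProofs
import Literature.NumberTheory.EllipticCurves.BSDInvariantsProofs
import HarnessLib

/-!
# Cremona's PLUS-SPACE criterion for `c = 1` (Agashe–Ribet–Stein 2006, appendix by J. E. Cremona,
# §5: condition `(*)`, Prop. 5.1 and the proof of Thm. 5.4), PROVED in the tree's vocabulary — a
# per-class certificate predicate `PlusPeriodClassBound` and its FACT-FREE consequence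
# `ClassAbsManinConstantEqOne`

Topic `Literature/NumberTheory/EllipticCurves`; namespace
`Literature.NumberTheory.EllipticCurves.ModularForms`. ONE predicate (a `def` with a free curve
argument; nothing asserted) and THEOREMS only: no named fact is introduced (D-0014/D-0026).
Sibling of `ManinConstantClassCertificate.lean` (`ClassAbsManinConstantEqOne`,
`OptimalCurveManinCertificate`), which it feeds.

## The print (first hand; page/line locators of the held text `paper:doi-10-4310-pamq-2006-v2-n2-a11`)

A. Agashe, K. Ribet, W. A. Stein, *The Manin constant*, PAMQ 2 (2006) 617–636, appendix §5 by
J. E. Cremona. Notation (p. 631–632): the isogeny class `E₁, …, E_m` attached to the rational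
newform `f`, Néron lattices `Λ_j` with "normalised generators" `ω_{1,j}, ω_{2,j}`, the TYPE of a
lattice ("type 1" non-rectangular = negative discriminant, "type 2" rectangular = positive
discriminant, [p0016:L4–14]), and the period lattice `Λ_f` of `f`. [p0016:L35–37]: "Pulling back
the Néron differential on `E_{j₀}` to `X₀(N)` gives `c · 2πi f(z) dz` where `c ∈ ℤ` is the Manin
constant for `f`. Hence `cΛ_f = Λ_{j₀}`." Condition `(*)` [p0016:L15–33]: `|ω_{1,1}/ω_{1,f} − 1| < ε`
(and the same for the imaginary generators). Prop. 5.1 [p0016:L51–p0017:L44]: "Suppose that `(*)`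
holds with `ε = B⁻¹`; then `j₀ = 1` and `c = 1`" — proof: "`ω_{1,j}/ω_{1,f} = c ∈ ℤ` … hence
`λ = 1`". Thm. 5.4 (`60000 < N < 130000`, PLUS SPACE ONLY) and its proof [p0018:L7–49]: "We do not
know the lattice `Λ_f` but only (to a certain precision) a positive real number `ω⁺_{1,f}` such
that either `Λ_f` has type 1 and `ω_{1,f} = 2ω⁺_{1,f}`, or `Λ_f` has type 2 and
`ω_{1,f} = ω⁺_{1,f}` … the ratio `λ` … satisfies `|λ − 1| < ε`. In all cases this holds with
`ε = 1/3`, which will suffice" [L9–22]; SAME TYPE: "from `cΛ_f = Λ_j` we deduce as before that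
`λ = 1` exactly, and `c = a₁/a_j = 1/a_j`, hence `c = a_j = 1` … though there might be some
ambiguity in which curve is optimal if `a_j = 1` for more than one value of `j`" [L24–29]; TYPE
1/2: "`ca_j = 2`. Hence either `c = 1` and `a_j = 2`, or `c = 2` and `a_j = 1` … for 15 of these
the level `N` is odd, so we know that `c` must be odd" [L30–35]; TYPE 2/1: "`2ca_j = 1`, which is
impossible" [L42–44].

## The dictionary print → tree (why no new notion is needed)

* `Ω(W) := W.realPeriodRat` (`BSDInvariants`) is the Néron real period WITH the number of real
  components: `Ω(W) = #π₀(E(ℝ)) · ω₁` (`realPeriodRat_eq_numRealComponents_mul`; `ω₁ = minRealPeriod`,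
  `#π₀ = 2` iff `Δ > 0` = Cremona's type 2). So for member `j`: `Ω(E_j) = t_j · ω_{1,j}` with `t_j`
  its type.
* `Ω⁺_f := plusPeriod f` (`ModularSymbols`) is the positive real with `re Λ_f = ℤ · Ω⁺_f/2`, i.e.
  `Ω⁺_f/2` is the least positive REAL PART of a period of `f` — exactly the number the plus space
  `H₁⁺(X₀(N), ℤ)` delivers (Cremona 1997 §2.8 "`Ω(f)` is twice the least real part of a period"),
  Cremona's `ω⁺_{1,f} = Ω⁺_f/2` up to his normalisation of [p0018:L11–16]: `ω_{1,f} = 2ω⁺_{1,f}`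
  (type 1) or `ω⁺_{1,f}` (type 2), i.e. `Ω(ℂ/Λ_f) = Ω⁺_f` in both types.
* Hence Cremona's `λ` of [p0018:L20] (curve 1 against the plus-space period, read with the type of
  `Λ₁`) is `λ = Ω(E₁)/Ω⁺_f` EXACTLY, in both types, and `(*)` reads `|Ω(E₁)/Ω⁺_f − 1| < 1/3`.
* "`cΛ_f = Λ_{j₀}`" for the optimal member is the tree's LATTICE CLAUSE
  `∀ z ∈ D.L.lattice, ∃ w ∈ periodLattice D.f, z = D.c * w` (with the structure field
  `c·Λ_f ⊆ Λ_W`), and the tree PROVES `Ω(W₀) = |c| · Ω⁺_f` for such a datum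
  (`ModularParametrizationData.realPeriodRat_eq_abs_mul_plusPeriod_of_latticeEq`, Cremona §2.8 /
  Edixhoven 1991 §1) and `c ≠ 0` (`maninConstant_ne_zero_holds`).

## What is proved here (the arithmetic of the printed proof, once, for every class)

For a lattice-optimal datum `D` on `W`: `Ω(W) = |c|·Ω⁺_f` with `|c| ≥ 1`, so
`Ω⁺_f ≤ Ω(W)` (`plusPeriod_le_realPeriodRat_of_latticeEq`), `Ω(W) < u·Ω⁺_f ⇒ |c| < u`
(`natAbs_maninConstant_lt_of_realPeriodRat_lt`), in particular **`Ω(W) < 2·Ω⁺_f ⇒ |c| = 1`**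
(`abs_maninConstant_eq_one_of_realPeriodRat_lt_two_mul`) and then `Ω(W) = Ω⁺_f`
(`realPeriodRat_eq_plusPeriod_of_latticeEq_of_lt_two_mul`: the optimal member is one of the
members whose Néron period equals `Ω⁺_f` — Cremona's "ambiguity in which curve is optimal").
Per CLASS, with the predicate `PlusPeriodClassBound W u` := "every globally minimal member `W'` of
the `ℚ`-isogeny class of `W` has `Ω(W') < u · Ω⁺_f` for the newform `f` of `W`":
* `classAbsManinConstantEqOne_of_plusPeriodClassBound_two` — **`u = 2` gives
  `ClassAbsManinConstantEqOne W` with NO named fact at all** (no Mazur / Abbes–Ullmo / Česnavičius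
  binder, no modularity binder, and no optimality LABEL: whichever member is optimal, its `c` is
  `±1`). In Cremona's letters (readers' configuration census of the cell `bsd-litref/manin`,
  sheets r2 ADD-13 / r1 ADD-13): when curve 1 has `a₁ = 1`, configurations A (`t₁ = 2`) and B
  (`t₁ = 1` and no type-2 member with `a_j = 1`) say precisely `Ω(E_j) ≤ Ω(E₁)` for all `j`
  (`a_j = ω_{1,1}/ω_{1,j} ∈ ℕ`, `Ω(E_j) = t_j ω_{1,j}`), and then `(*)` gives
  `Ω(E_j) ≤ Ω(E₁) = λΩ⁺_f < (4/3)Ω⁺_f < 2Ω⁺_f`: constructor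
  `PlusPeriodClassBound.of_realPeriodRat_le_of_lt`. Only the UPPER half `λ < 2` of `(*)` is used.
* `classAbsManinConstantEqOne_of_plusPeriodClassBound_of_sieve` — general `u`, modulo Abbes–Ullmo
  1996 Thm. A (`abbesUllmo_not_dvd_maninConstant_of_not_dvd_level`: `q ∤ N ⇒ q ∤ c`) and modularity
  (levels = conductor): if every integer `2 ≤ n < u` has a prime factor `q ∤ N(W)`, then
  `ClassAbsManinConstantEqOne W`; the case `u = 3`, `N` odd
  (`classAbsManinConstantEqOne_of_plusPeriodClassBound_three_of_odd`) is the printed step "the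
  level `N` is odd, so we know that `c` must be odd" [p0018:L34–35] (configuration C: a type-2
  member with `a_j = 1` has `Ω(E_j) = 2λΩ⁺_f < (8/3)Ω⁺_f < 3Ω⁺_f`).
* Bookkeeping: `PlusPeriodClassBound.mono`, `.of_isIsogenous` (class invariance),
  `.of_conductorLevel` (the datum at the conductor level only, modulo `exists_isNewformOf`), and the
  TWO-LEG form of a certificate row, `.of_finset` / `.of_finset_le_of_lt`: a finite set `F` of
  globally minimal models meeting the `ℤ`-isomorphism class of every minimal member (COMPLETENESS of
  the class list, in the rendering of `WeierstrassCurve.finite_isogenyClass`; the real period is the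
  same on two minimal models, `realPeriodRat_variableChange_of_isGloballyMinimal_holds`) and one
  period inequality per listed model.
What is NOT proved and not claimed: Prop. 5.1's identification `j₀ = 1` (it needs the imaginary
generators, i.e. the full space); any VALUE of a period. The hypothesis `PlusPeriodClassBound W u`
is a DISPLAYED DATUM about transcendental numbers (one plus-space real period of `f` at level `N`
against the AGM periods of the listed minimal models, plus completeness of the class list), of the
same species as Cremona's `(*)`; its attestation (print for `N < 130000` [p0018:L19–22], the
database note `manin.txt` for `N ≤ 500000`, or an independent two-implementation interval
computation) is not a matter for this file. HONEST FRAMING: typed ≠ proved ≠ endorsed; nothing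
here moves a class by itself.

## References
* [AgasheRibetStein2006] A. Agashe, K. Ribet, W. A. Stein, *The Manin constant*, Pure Appl.
  Math. Q. 2 (2006) 617–636; appendix §5 (J. E. Cremona): condition `(*)` p. 632, Prop. 5.1
  pp. 632–633, Thm. 5.2 p. 633, Thm. 5.4 and its proof p. 634.
* [CremonaAlgorithms1997] J. E. Cremona, *Algorithms for modular elliptic curves*, 2nd ed., CUP
  1997, §2.8 (p. 26) (the plus space and `re Λ_f`), §2.10 (the Manin constant).
* [AbbesUllmo1996] A. Abbes, E. Ullmo, Compositio Math. 103 (1996) 269–286, Thm. A.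
* [Cremona2022ManinConstants] J. E. Cremona, *Manin constants and optimal curves*,
  `ecdata/doc/manin.txt` (the same method "using the plus space only" beyond `130000`).
-/

noncomputable section

open scoped MatrixGroups ModularForm

open CongruenceSubgroup WeierstrassCurve

namespace Literature.NumberTheory.EllipticCurves.ModularForms

/-! ### Per datum: the Manin constant of a lattice-optimal datum is read off `Ω(W)/Ω⁺_f` -/

namespace ModularParametrizationData

variable {W : WeierstrassCurve ℚ} {N : ℕ} [NeZero N] (D : ModularParametrizationData W N)

/-- `Ω⁺_f > 0` for the newform of a parametrisation datum (the newform of an elliptic curve is a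
rational newform; `IsNewform0.plusPeriod_pos_holds`). [cite: CremonaAlgorithms1997, §2.8] -/
theorem plusPeriod_newform_pos : 0 < plusPeriod D.f :=
  IsNewform0.plusPeriod_pos_holds D.isNewformOf.1 D.isNewformOf.coeffField_eq_bot

/-- **`Ω⁺_f ≤ Ω(W₀)` on the optimal curve.** For a lattice-optimal datum (`Λ_W = c·Λ_f`),
`Ω(W) = |c| · Ω⁺_f` (`realPeriodRat_eq_abs_mul_plusPeriod_of_latticeEq`) with `c ∈ ℤ ∖ {0}`, so
`Ω⁺_f ≤ Ω(W)`: a member whose Néron period is `< Ω⁺_f` is not the optimal curve (Cremona's case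
"`2ca_j = 1`, which is impossible"). [cite: AgasheRibetStein2006, appendix §5, proof of Thm. 5.4 (p. 634)] -/
theorem plusPeriod_le_realPeriodRat_of_latticeEq [W.IsElliptic]
    (hopt : ∀ z ∈ D.L.lattice, ∃ w ∈ periodLattice D.f, z = D.c * w) :
    plusPeriod D.f ≤ W.realPeriodRat := by
  have hplus := D.plusPeriod_newform_pos
  have hc : (1 : ℝ) ≤ |(D.c : ℝ)| := by
    have h1 : (1 : ℤ) ≤ |D.c| := Int.one_le_abs D.maninConstant_ne_zero_holds
    have h2 : ((1 : ℤ) : ℝ) ≤ ((|D.c| : ℤ) : ℝ) := Int.cast_le.mpr h1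
    simpa [Int.cast_abs] using h2
  rw [D.realPeriodRat_eq_abs_mul_plusPeriod_of_latticeEq hopt]
  nlinarith

/-- A member with `Ω(W) < Ω⁺_f` carries no lattice-optimal datum with newform `f` (contrapositive
of `plusPeriod_le_realPeriodRat_of_latticeEq`). [cite: AgasheRibetStein2006, appendix §5, proof of Thm. 5.4 (p. 634)] -/
theorem not_latticeEq_of_realPeriodRat_lt_plusPeriod [W.IsElliptic]
    (hlt : W.realPeriodRat < plusPeriod D.f) :
    ¬ ∀ z ∈ D.L.lattice, ∃ w ∈ periodLattice D.f, z = D.c * w :=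
  fun hopt ↦ (not_lt.mpr (D.plusPeriod_le_realPeriodRat_of_latticeEq hopt)) hlt

/-- **The Manin constant is bounded by the period ratio.** For a lattice-optimal datum and a
natural number `u`: `Ω(W) < u · Ω⁺_f ⇒ |c| < u` (as `Ω(W) = |c| · Ω⁺_f`, `Ω⁺_f > 0`) — the
arithmetic "`ω_{1,j}/ω_{1,f} = c ∈ ℤ`" of the proof of Prop. 5.1 in the plus-space normalisation
of Thm. 5.4. [cite: AgasheRibetStein2006, appendix §5, Prop. 5.1 (proof, p. 633) and Thm. 5.4 (proof, p. 634)] -/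
theorem natAbs_maninConstant_lt_of_realPeriodRat_lt [W.IsElliptic]
    (hopt : ∀ z ∈ D.L.lattice, ∃ w ∈ periodLattice D.f, z = D.c * w) {u : ℕ}
    (hlt : W.realPeriodRat < u * plusPeriod D.f) : D.maninConstant.natAbs < u := by
  have hplus := D.plusPeriod_newform_pos
  rw [D.realPeriodRat_eq_abs_mul_plusPeriod_of_latticeEq hopt] at hlt
  have h1 : |(D.c : ℝ)| < u := lt_of_mul_lt_mul_right hlt hplus.le
  have h2 : ((D.c.natAbs : ℤ) : ℝ) < u := by
    rw [Int.natCast_natAbs, Int.cast_abs]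
    exact h1
  have h3 : (D.c.natAbs : ℝ) < u := by exact_mod_cast h2
  exact_mod_cast h3

/-- **`Ω(W₀) < 2 · Ω⁺_f ⇒ |c| = 1`** for a lattice-optimal datum: `|c| < 2` and `c ≠ 0`. This is
the conclusion "`c = a_j = 1`" of the same-type case and "`c = 1` and `a_j = 2`" of the type-1/2
case of the proof of Thm. 5.4, read on the optimal member itself.
[cite: AgasheRibetStein2006, appendix §5, proof of Thm. 5.4 (p. 634 L23–31)] -/
theorem abs_maninConstant_eq_one_of_realPeriodRat_lt_two_mul [W.IsElliptic]
    (hopt : ∀ z ∈ D.L.lattice, ∃ w ∈ periodLattice D.f, z = D.c * w)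
    (hlt : W.realPeriodRat < 2 * plusPeriod D.f) : |D.maninConstant| = 1 := by
  have h2 : D.maninConstant.natAbs < 2 :=
    D.natAbs_maninConstant_lt_of_realPeriodRat_lt hopt (u := 2) (by exact_mod_cast hlt)
  have h1 : 0 < D.maninConstant.natAbs := Int.natAbs_pos.mpr D.maninConstant_ne_zero_holds
  have h : D.maninConstant.natAbs = 1 := by omega
  rw [← Int.natCast_natAbs, h, Nat.cast_one]

/-- Under `Ω(W₀) < 2 · Ω⁺_f` the optimal member has `Ω(W₀) = Ω⁺_f` EXACTLY ("`λ = 1` exactly",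
proof of Thm. 5.4): so the optimal curve is one of the members whose Néron period equals `Ω⁺_f`
— Cremona's "ambiguity in which curve is optimal if `a_j = 1` for more than one value of `j`".
[cite: AgasheRibetStein2006, appendix §5, proof of Thm. 5.4 (p. 634 L26–29)] -/
theorem realPeriodRat_eq_plusPeriod_of_latticeEq_of_lt_two_mul [W.IsElliptic]
    (hopt : ∀ z ∈ D.L.lattice, ∃ w ∈ periodLattice D.f, z = D.c * w)
    (hlt : W.realPeriodRat < 2 * plusPeriod D.f) : W.realPeriodRat = plusPeriod D.f := by
  have h1 : |D.maninConstant| = 1 := D.abs_maninConstant_eq_one_of_realPeriodRat_lt_two_mul hopt hlt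
  have h1' : |(D.c : ℝ)| = 1 := by
    have h := congrArg (fun z : ℤ ↦ (z : ℝ)) h1
    simpa [maninConstant, Int.cast_abs] using h
  rw [D.realPeriodRat_eq_abs_mul_plusPeriod_of_latticeEq hopt, h1', one_mul]

end ModularParametrizationData

/-! ### The per-class certificate predicate -/

/-- **Cremona's plus-space test for an isogeny class, with bound `u`** (Agashe–Ribet–Stein 2006,
appendix §5, condition `(*)` and the proof of Thm. 5.4, in the tree's normalisation): every
globally minimal model `W'` of a curve `ℚ`-isogenous to `W` has Néron real period (components
included) `Ω(W') < u · Ω⁺_f`, for the newform `f` of `W` (at whatever level it is written; by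
multiplicity one only the conductor, `PlusPeriodClassBound.of_conductorLevel`). With `u = 2` this
is configuration "same type, or type 1/2 with `a_j = 2`" of the printed proof (`Ω(E_j) ≤ Ω(E₁)` for
all `j`) together with the upper half `λ = Ω(E₁)/Ω⁺_f < 2` of `(*)`. A PREDICATE (displayed datum
about periods: one plus-space real period of `f` against the AGM periods of the listed minimal
models, and completeness of that list); nothing is asserted.
[cite: AgasheRibetStein2006, appendix §5, (*) (p. 632) and proof of Thm. 5.4 (p. 634)] -/
def PlusPeriodClassBound (W : WeierstrassCurve ℚ) (u : ℕ) : Prop :=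
  ∀ (W' : WeierstrassCurve ℚ) [W'.IsElliptic] [W'.IsGloballyMinimal] {N' : ℕ} [NeZero N']
    (f : CuspForm (Gamma0 N') 2), IsIsogenous W W' → IsNewformOf W f →
    W'.realPeriodRat < u * plusPeriod f

namespace PlusPeriodClassBound

variable {W : WeierstrassCurve ℚ} {u : ℕ}

/-- Monotonicity in the bound. [cite: AgasheRibetStein2006, appendix §5] -/
theorem mono [W.IsElliptic] (h : PlusPeriodClassBound W u) {v : ℕ} (huv : u ≤ v) :
    PlusPeriodClassBound W v := by
  intro W' _ _ N' _ f hiso hf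
  have hplus : 0 < plusPeriod f := IsNewform0.plusPeriod_pos_holds hf.1 hf.coeffField_eq_bot
  exact (h W' f hiso hf).trans_le
    (mul_le_mul_of_nonneg_right (Nat.cast_le.mpr huv) hplus.le)

/-- **Class invariance**: the predicate depends only on the `ℚ`-isogeny class (isogenous curves
have the same newform, `IsNewformOf.of_isIsogenous`; transitivity `IsIsogenous.trans'`).
[cite: Knapp1993, Thm. 11.67] -/
theorem of_isIsogenous [W.IsElliptic] (h : PlusPeriodClassBound W u) {V : WeierstrassCurve ℚ}
    [V.IsElliptic] (hWV : IsIsogenous W V) : PlusPeriodClassBound V u :=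
  fun W' _ _ _ _ f hVW' hf ↦ h W' f (IsIsogenous.trans' hWV hVW') (hf.of_isIsogenous hWV)

/-- **The datum at the conductor level suffices** (modulo the modularity fact
`exists_isNewformOf`, used only through `IsNewformOf.level_eq_conductorNorm_of_exists_isNewformOf`:
a newform of `W` lives at level `N(W)`): the engine-side statement "for the newform
`f ∈ S₂(Γ₀(N(W)))` of `W`, every minimal member `W'` has `Ω(W') < u · Ω⁺_f`" gives the predicate.
[cite: DiamondShurman2005, Thm. 8.8.1] [cite: AgasheRibetStein2006, appendix §5] -/
theorem of_conductorLevel (hnf : exists_isNewformOf) [W.IsElliptic]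
    (h : ∀ (W' : WeierstrassCurve ℚ) [W'.IsElliptic] [W'.IsGloballyMinimal]
      [NeZero (W.conductorNorm ℤ)] (f : CuspForm (Gamma0 (W.conductorNorm ℤ)) 2),
      IsIsogenous W W' → IsNewformOf W f → W'.realPeriodRat < u * plusPeriod f) :
    PlusPeriodClassBound W u := by
  intro W' _ _ N' _ f hiso hf
  have hN : N' = W.conductorNorm ℤ :=
    IsNewformOf.level_eq_conductorNorm_of_exists_isNewformOf hnf hf
  subst hN
  exact h W' f hiso hf

/-- **The printed shape** (proof of Thm. 5.4 with reference curve `E₁ = W₁`): if every globally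
minimal member of the class has Néron period `≤ Ω(W₁)` (Cremona: `a₁ = 1` and configuration "same
type / type 1–2 with `a_j ≥ 2`", i.e. `Ω(E_j) = t_j ω_{1,1}/a_j ≤ t₁ ω_{1,1} = Ω(E₁)`), and the
plus-space comparison `Ω(W₁) < u · Ω⁺_f` holds for the newform of `W₁` (for `u = 2`: the upper
half of `(*)`, `λ < 4/3 < 2`), then `PlusPeriodClassBound W₁ u`.
[cite: AgasheRibetStein2006, appendix §5, (*) (p. 632, p. 634 L19–22) and proof of Thm. 5.4 (p. 634 L23–31)] -/
theorem of_realPeriodRat_le_of_lt {W₁ : WeierstrassCurve ℚ} [W₁.IsElliptic] {u : ℕ}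
    (hmax : ∀ (W' : WeierstrassCurve ℚ) [W'.IsElliptic] [W'.IsGloballyMinimal],
      IsIsogenous W₁ W' → W'.realPeriodRat ≤ W₁.realPeriodRat)
    (hstar : ∀ {N : ℕ} [NeZero N] (f : CuspForm (Gamma0 N) 2), IsNewformOf W₁ f →
      W₁.realPeriodRat < u * plusPeriod f) :
    PlusPeriodClassBound W₁ u :=
  fun W' _ _ _ _ f hiso hf ↦ (hmax W' hiso).trans_lt (hstar f hf)

end PlusPeriodClassBound

/-! ### From the predicate to `ClassAbsManinConstantEqOne` -/

/-- **Cremona's plus-space criterion, bound `2` — FACT-FREE.** If every globally minimal member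
`W'` of the isogeny class of `W` has `Ω(W') < 2 · Ω⁺_f` (`PlusPeriodClassBound W 2`), then the
optimal curve of the class has Manin constant `±1` (`ClassAbsManinConstantEqOne W`): whichever
member `W'` carries a lattice-optimal datum `D'` (at any level), `Ω(W') = |c| · Ω⁺_{f}` with
`f = D'.f` the newform of `W'`, hence of `W`, so `|c| < 2`, `|c| = 1`. No Manin-constant fact, no
modularity fact and no optimality label enter. This is the proof of Thm. 5.4 in the cases "same
type" and "type 1/2 with `a_j = 2`" [p0018:L23–31], for one class, with `(*)` displayed.
[cite: AgasheRibetStein2006, appendix §5, proof of Thm. 5.4 (p. 634)] -/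
theorem classAbsManinConstantEqOne_of_plusPeriodClassBound_two (W : WeierstrassCurve ℚ)
    [W.IsElliptic] (h : PlusPeriodClassBound W 2) : ClassAbsManinConstantEqOne W := by
  intro W' _ _ N' _ D' hiso hopt
  have hf : IsNewformOf W D'.f := D'.isNewformOf.of_isIsogenous hiso
  exact D'.abs_maninConstant_eq_one_of_realPeriodRat_lt_two_mul hopt (by exact_mod_cast h W' D'.f hiso hf)

/-- The record-side binder from the bound-`2` test: `¬ p ∣ c` for EVERY prime `p`, every optimal
datum of every globally minimal member (`ClassAbsManinConstantEqOne.not_dvd_maninConstant`).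
[cite: AgasheRibetStein2006, appendix §5, proof of Thm. 5.4 (p. 634)] -/
theorem not_dvd_maninConstant_of_plusPeriodClassBound_two (W : WeierstrassCurve ℚ) [W.IsElliptic]
    (h : PlusPeriodClassBound W 2) {W' : WeierstrassCurve ℚ} [W'.IsElliptic] [W'.IsGloballyMinimal]
    {N' : ℕ} [NeZero N'] (D' : ModularParametrizationData W' N') (hiso : IsIsogenous W W')
    (hopt : ∀ z ∈ D'.L.lattice, ∃ w ∈ periodLattice D'.f, z = D'.c * w) {p : ℕ} (hp : p.Prime) :
    ¬ (p : ℤ) ∣ D'.maninConstant :=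
  (classAbsManinConstantEqOne_of_plusPeriodClassBound_two W h).not_dvd_maninConstant D' hiso hopt hp

/-- **Cremona's plus-space criterion with the Abbes–Ullmo sieve, general bound `u`.** Modulo
Abbes–Ullmo 1996 Thm. A (`abbesUllmo_not_dvd_maninConstant_of_not_dvd_level`: a prime not dividing
the level does not divide the Manin constant of the optimal curve) and modularity
(`exists_isNewformOf`, levels = conductor, `level_eq_conductorNorm_of_isIsogenous`): if
`PlusPeriodClassBound W u` and every integer `n` with `2 ≤ n < u` has a prime factor `q ∤ N(W)`, then
`ClassAbsManinConstantEqOne W` — on the optimal member `|c| < u`, `c ≠ 0`, and `|c| = n ≥ 2` would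
have a prime factor `q ∣ c`, `q ∤ N`. [cite: AgasheRibetStein2006, appendix §5, proof of Thm. 5.4 (p. 634 L30–35)]
[cite: AbbesUllmo1996, Thm. A] -/
theorem classAbsManinConstantEqOne_of_plusPeriodClassBound_of_sieve
    (hAU : abbesUllmo_not_dvd_maninConstant_of_not_dvd_level) (hnf : exists_isNewformOf)
    (W : WeierstrassCurve ℚ) [W.IsElliptic] {u : ℕ} (h : PlusPeriodClassBound W u)
    (hsieve : ∀ n : ℕ, 2 ≤ n → n < u → ∃ q : ℕ, q.Prime ∧ q ∣ n ∧ ¬ q ∣ W.conductorNorm ℤ) :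
    ClassAbsManinConstantEqOne W := by
  intro W' _ _ N' _ D' hiso hopt
  have hf : IsNewformOf W D'.f := D'.isNewformOf.of_isIsogenous hiso
  have hlt : D'.maninConstant.natAbs < u :=
    D'.natAbs_maninConstant_lt_of_realPeriodRat_lt hopt (h W' D'.f hiso hf)
  have h1 : 0 < D'.maninConstant.natAbs := Int.natAbs_pos.mpr D'.maninConstant_ne_zero_holds
  by_contra hne
  have hne' : D'.maninConstant.natAbs ≠ 1 := by
    intro h1'
    exact hne (by rw [← Int.natCast_natAbs, h1', Nat.cast_one])
  have h2 : 2 ≤ D'.maninConstant.natAbs := by omega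
  obtain ⟨q, hq, hqn, hqN⟩ := hsieve _ h2 hlt
  have hN' : N' = W.conductorNorm ℤ := level_eq_conductorNorm_of_isIsogenous hnf D' hiso
  have hqN' : ¬ q ∣ N' := hN' ▸ hqN
  exact hAU W' D' hopt q hq hqN' (Int.natCast_dvd.mpr hqn)

/-- **The printed parity step, per class: `N` odd ⇒ `c` odd, so bound `3` suffices.** Modulo
Abbes–Ullmo Thm. A and modularity: if `N(W)` is odd and every globally minimal member has
`Ω(W') < 3 · Ω⁺_f`, then `ClassAbsManinConstantEqOne W` (`|c| ∈ {1, 2}` and `2 ∤ c`). This is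
configuration "type 1/2 with `a_j = 1`, `N` odd" of the proof of Thm. 5.4: such a member has
`Ω(E_j) = 2λ · Ω⁺_f < (8/3) Ω⁺_f`. [cite: AgasheRibetStein2006, appendix §5, proof of Thm. 5.4 (p. 634 L30–35)]
[cite: AbbesUllmo1996, Thm. A] -/
theorem classAbsManinConstantEqOne_of_plusPeriodClassBound_three_of_odd
    (hAU : abbesUllmo_not_dvd_maninConstant_of_not_dvd_level) (hnf : exists_isNewformOf)
    (W : WeierstrassCurve ℚ) [W.IsElliptic] (hodd : ¬ 2 ∣ W.conductorNorm ℤ)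
    (h : PlusPeriodClassBound W 3) : ClassAbsManinConstantEqOne W :=
  classAbsManinConstantEqOne_of_plusPeriodClassBound_of_sieve hAU hnf W h fun n h2 h3 ↦
    ⟨2, Nat.prime_two, by interval_cases n; exact dvd_rfl, hodd⟩

/-- **The printed theorem's shape, per class, fact-free**: reference curve `W₁` with the largest
Néron period in its class and `Ω(W₁) < 2 · Ω⁺_f` for its newform ⇒ the optimal curve of the class
has `c = ±1` (`PlusPeriodClassBound.of_realPeriodRat_le_of_lt` followed by
`classAbsManinConstantEqOne_of_plusPeriodClassBound_two`).
[cite: AgasheRibetStein2006, appendix §5, (*) and proof of Thm. 5.4 (p. 634)] -/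
theorem classAbsManinConstantEqOne_of_realPeriodRat_le_of_lt_two_mul (W₁ : WeierstrassCurve ℚ)
    [W₁.IsElliptic]
    (hmax : ∀ (W' : WeierstrassCurve ℚ) [W'.IsElliptic] [W'.IsGloballyMinimal],
      IsIsogenous W₁ W' → W'.realPeriodRat ≤ W₁.realPeriodRat)
    (hstar : ∀ {N : ℕ} [NeZero N] (f : CuspForm (Gamma0 N) 2), IsNewformOf W₁ f →
      W₁.realPeriodRat < 2 * plusPeriod f) :
    ClassAbsManinConstantEqOne W₁ :=
  classAbsManinConstantEqOne_of_plusPeriodClassBound_two W₁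
    (PlusPeriodClassBound.of_realPeriodRat_le_of_lt hmax fun f hf ↦ by exact_mod_cast hstar f hf)

/-! ### The two legs of a certificate row: a COMPLETE finite list of minimal models, and one
period inequality per listed model -/

namespace PlusPeriodClassBound

variable {W : WeierstrassCurve ℚ} {u : ℕ}

/-- **The predicate from a finite list of minimal models (two legs).** Leg 1 (COMPLETENESS of
the class list, in the rendering of `WeierstrassCurve.finite_isogenyClass`): a finite set `F` of
Weierstrass models such that every globally minimal model `W'` of a curve `ℚ`-isogenous to `W` is
carried by some change of variables `C` to a GLOBALLY MINIMAL member `C • W' ∈ F` (two minimal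
models of one curve differ by `u = ±1`, so `Ω(C • W') = Ω(W')`,
`realPeriodRat_variableChange_of_isGloballyMinimal_holds`). Leg 2 (the period data): every
`V ∈ F` has `Ω(V) < u · Ω⁺_f` for the newform `f` of `W`. Then `PlusPeriodClassBound W u`. This
is the shape of one row of Cremona's computation (input "(3) a complete isogeny class of elliptic
curves `{E₁, …, E_m}` of conductor `N`, given by minimal models" [p0015:L24–25], their AGM
periods [p0016:L10–14], and the plus-space period of `f` [p0018:L9–16]).
[cite: AgasheRibetStein2006, appendix §5 (pp. 631–634)] [cite: Knapp1993, Thm. 10.3] -/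
theorem of_finset (F : Finset (WeierstrassCurve ℚ))
    (hF : ∀ (W' : WeierstrassCurve ℚ) [W'.IsElliptic] [W'.IsGloballyMinimal], IsIsogenous W W' →
      ∃ C : VariableChange ℚ, (C • W').IsGloballyMinimal ∧ C • W' ∈ F)
    (hΩ : ∀ V ∈ F, ∀ {N' : ℕ} [NeZero N'] (f : CuspForm (Gamma0 N') 2), IsNewformOf W f →
      V.realPeriodRat < u * plusPeriod f) :
    PlusPeriodClassBound W u := by
  intro W' _ _ N' _ f hiso hf
  obtain ⟨C, hmin, hmem⟩ := hF W' hiso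
  haveI := hmin
  have hΩeq : (C • W').realPeriodRat = W'.realPeriodRat :=
    WeierstrassCurve.realPeriodRat_variableChange_of_isGloballyMinimal_holds W' C
  rw [← hΩeq]
  exact hΩ _ hmem f hf

/-- **The printed shape on a finite list**: leg 1 as in `of_finset`; leg 2 split as Cremona
does — a reference model `W₁` (his curve `E₁`) with `Ω(V) ≤ Ω(W₁)` for every listed `V`
(configurations "same type / type 1–2 with `a_j ≥ 2`"), and the plus-space comparison
`Ω(W₁) < u · Ω⁺_f` (`u = 2`: the upper half of `(*)`). Then `PlusPeriodClassBound W u` for the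
class of `W` (any base member `W`; `W₁` need not be `W`).
[cite: AgasheRibetStein2006, appendix §5, (*) (p. 632) and proof of Thm. 5.4 (p. 634)] -/
theorem of_finset_le_of_lt (F : Finset (WeierstrassCurve ℚ)) (W₁ : WeierstrassCurve ℚ)
    (hF : ∀ (W' : WeierstrassCurve ℚ) [W'.IsElliptic] [W'.IsGloballyMinimal], IsIsogenous W W' →
      ∃ C : VariableChange ℚ, (C • W').IsGloballyMinimal ∧ C • W' ∈ F)
    (hmax : ∀ V ∈ F, V.realPeriodRat ≤ W₁.realPeriodRat)
    (hstar : ∀ {N' : ℕ} [NeZero N'] (f : CuspForm (Gamma0 N') 2), IsNewformOf W f →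
      W₁.realPeriodRat < u * plusPeriod f) :
    PlusPeriodClassBound W u :=
  of_finset F hF fun V hV _ _ f hf ↦ (hmax V hV).trans_lt (hstar f hf)

end PlusPeriodClassBound

/-- **One certificate row, two legs, bound `2` — FACT-FREE**: a complete finite list `F` of
globally minimal models of the class of `W` (leg 1) on which every model has `Ω(V) < 2 · Ω⁺_f`
(leg 2) gives `ClassAbsManinConstantEqOne W`.
[cite: AgasheRibetStein2006, appendix §5, proof of Thm. 5.4 (p. 634)] -/
theorem classAbsManinConstantEqOne_of_finset_lt_two_mul (W : WeierstrassCurve ℚ) [W.IsElliptic]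
    (F : Finset (WeierstrassCurve ℚ))
    (hF : ∀ (W' : WeierstrassCurve ℚ) [W'.IsElliptic] [W'.IsGloballyMinimal], IsIsogenous W W' →
      ∃ C : VariableChange ℚ, (C • W').IsGloballyMinimal ∧ C • W' ∈ F)
    (hΩ : ∀ V ∈ F, ∀ {N' : ℕ} [NeZero N'] (f : CuspForm (Gamma0 N') 2), IsNewformOf W f →
      V.realPeriodRat < 2 * plusPeriod f) :
    ClassAbsManinConstantEqOne W :=
  classAbsManinConstantEqOne_of_plusPeriodClassBound_two W
    (PlusPeriodClassBound.of_finset F hF fun V hV _ _ f hf ↦ by exact_mod_cast hΩ V hV f hf)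

end Literature.NumberTheory.EllipticCurves.ModularForms

end
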